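import Summits.BirchSwinnertonDyer.BirchSwinnertonDyer.Theorems.InertBadSignedBranchesInertBadAtThreeIstarZeroOddSupply
import Summits.BirchSwinnertonDyer.BirchSwinnertonDyer.Theorems.InertBadSignedBranchesInertBadAtThreeIstarZeroOddPair
import HarnessLib

/-!
# Route `InertBadSignedBranches` (rung K8), residual crux `InertBadAtThree` — file 4/4: `BSD(W, p)` and the
# typed missing input on the type `(p, I₀*)` at ANY ODD prime and at `p = 3` (seat bsd-cm-inert g10)

The landed O10-PS chain (`X12/ClassClosureO10Readings.lean`, p402929; x1b's
`Additive/QuadraticBranchLowerHalfOfReadings.lean`) carries `hp5 : 5 ≤ p` for exactly three reasons: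
(i) `p ≠ 2`; (ii) `ord_p c_p(W) = 0` by Kodaira–Néron (`c_p ≤ 4 < p`); (iii) the typed law
`Additive.QuadraticBranchMinusLeadingValuationAt W p 0` (C-cc-1) has `5 ≤ p →` inside its body, so it
can only be USED at `p ≥ 5`. At `p = 3` on the inert-bad CM locus (ii) holds for a different reason —
`3 ∤ Tam(W)` for every CM curve with `3` unramified in the CM field
(`X12.not_three_dvd_tamagawaProduct_of_hasCM_of_not_cmRamified_three`) — and (iii) is the planner's
to restate (a guard-free twin of the law; cell bsd-cm ruling D70 after the referee's PASS on memo N21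
v1.2, which removed the paper obstruction (GZ_η)@3 at `e = p − 1`).

THIS FILE (4/4): the UPPER side as well — `exactControlValue_of_readings_of_ne_two` ((C3_η) AT THE
PAIR at odd `p` from `hPT`, GZK, (R2) typed and the exact Kobayashi-7.4 reading; x1b's file 123 §1 with
`5 ≤ p` ↦ `p ≠ 2` + `ord_p c_p(W) = 0`), `bsdp_of_pairValuation_of_readings_of_ne_two` (Miller's
`BSD(W, p)` from the law's VALUE at the pair + the readings; cc-typer-6's p307042 §4 in pair form),
`missingInputAt_IstarZero_of_pairLaw_of_readings_of_ne_two` (∀ `W` of signed type `(p, I₀*)`,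
`r_an = 1`: `Typed.X12.MissingInputAt W p` modulo the law in pair form, (C1_η), the readings, the named
facts, `hper`, `ord_p c_p = 0`) and its `p = 3` instance
`missingInputAt_IstarZero_three_of_pairLaw_of_readings` = THE D71 CHILD `InertBadAtThreeIstarZero`
MODULO C-cc-1@3 ∧ (C1_η)@3 ∧ named facts ∧ readings ∧ `hper` (Tamagawa hypothesis discharged).

HONEST STATUS (all four files). Everything is CONDITIONAL on displayed hypotheses: the law (C-cc-1) in
pair form, (C1_η), the reading `h74l` and the period datum `hper` are hypotheses, NOT claimed; the two
residual cruxes of the route stay open; nothing is booked; no label moves. With the three files the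
`I₀*`-at-3 half of `InertBadAtThree` reads "kernel modulo C-cc-1@3 ∧ (C1_η)@3 ∧ named facts ∧ one
reading ∧ `hper`", exactly like the `p ≥ 5` node of record (`X12/ClassClosureO10Readings.lean`,
p402929); the `III/III*`-at-3 half is untouched (CONSTRUCTION).
[cite: Kobayashi2003, §4 (p. 8), Thm. 7.4 (p. 13), Thm. 3.2 (p. 7)] [cite: Miller2011LMS, Def. 1.1]
[cite: SilvermanATAEC1994, IV.9.4 and Table 4.1]
-/

set_option autoImplicit false
set_option linter.dupNamespace false

noncomputable section

open scoped Classical MatrixGroups ModularForm NumberField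

open CongruenceSubgroup Field Function NumberField IsDedekindDomain IsDedekindDomain.HeightOneSpectrum
  WeierstrassCurve Rat.HeightOneSpectrum
open Literature.NumberTheory.EllipticCurves
open Literature.NumberTheory.EllipticCurves.ModularForms
open Literature.NumberTheory.EllipticCurves.Kobayashi2003
open Literature.NumberTheory.EllipticCurves.Rank1Residual
open Literature.NumberTheory.EllipticCurves.Rank1Residual.Typed
open Literature.NumberTheory.GaloisRepresentations
open Literature.NumberTheory.GaloisCohomology
open Literature.NumberTheory.EllipticCurves.IwasawaAlgebra
open Summit.BirchSwinnertonDyer.Rank1Residual.Additive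
open Summit.BirchSwinnertonDyer.Rank1Residual.Additive.LevelBridge
open Summit.BirchSwinnertonDyer.Rank1Residual
open Summit.BirchSwinnertonDyer.Rank1Residual.X12
open Summit.BirchSwinnertonDyer.Rank1Residual.X12.O10

namespace Summit.BirchSwinnertonDyer.BirchSwinnertonDyer.Theorems.InertBadOdd

variable (W : WeierstrassCurve ℚ) [W.IsElliptic] (p : ℕ) [hp : Fact p.Prime]

variable {p}

/-! ## §4 `BSD(W, p)` and the typed missing input at an odd prime from the pair VALUES (exact reading + (R2)) -/

section BSDpPair

variable [W.IsGloballyMinimal] {V : WeierstrassCurve ℚ} [V.IsElliptic] [V.IsGloballyMinimal]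
  {C : VariableChange ℚ} {N : ℕ} [NeZero N] {f : CuspForm (Gamma0 N) 2} {ϖ : ℚ} {L : IwasawaAlgebra p}
  {P : W.toAffine.Point} {n : ℕ}

/-- **(C3_η) AT THE PAIR at any ODD `p`: `Sel_str(W/ℚ)[p^∞]` finite and
`ord_p #Sel_str + n + ord_p(Tam(W)/#W(ℚ)_tors²) = v_p(coeff₁ L)`** from `hPT`, GZK, the typed reading (R2)
`OddBranchStrictMinusNoFiniteSubmoduleAt W p` and the EXACT Kobayashi-7.4 reading `h74x` — x1b's file 123 §1
(`quadraticBranchOddStrictExactControlOfPlusMCAt_of_readings`) with `5 ≤ p` replaced by `p ≠ 2` +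
`ord_p c_p(W) = 0`; proof verbatim otherwise. CONDITIONAL; nothing asserted about the printed theorems.
[cite: Kobayashi2003, Thm. 7.4 (p. 13), §4 (p. 8), Thm. 9.3 (p. 26)]
[cite: KitajimaOtsuki2018, Main Thm. 1.3 (arXiv:1607.03612 p. 3)] [cite: MilneADT2006, Ch. I, Thm. 4.10] -/
theorem exactControlValue_of_readings_of_ne_two
    (hPT : poitouTate_selmerStructure_duality_real ℚ)
    (hGZK : rank_eq_analyticRank_of_analyticRank_le_one)
    (hR2 : OddBranchStrictMinusNoFiniteSubmoduleAt W p)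
    (h74x : ∀ (V : WeierstrassCurve ℚ) [V.IsElliptic] [V.IsGloballyMinimal] (C : VariableChange ℚ)
        {N : ℕ} [NeZero N] {f : CuspForm (Gamma0 N) 2},
        p ≠ 2 → C • W.quadraticTwist ((-1) ^ (p / 2) * p) = V →
        V.HasGoodReductionAtPrime p → V.frobeniusTrace p = 0 →
        QuadraticBranchPlusMainConjectureAt V p → IsNewformOf V f →
        ∀ (ϖ : ℚ), (if Even (p / 2) then (ϖ : ℝ) * V.realPeriodRat = plusPeriod f
            else (ϖ : ℝ) * V.imaginaryPeriodRat = minusPeriod f) →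
        ∀ (Lη : IwasawaAlgebra p), IsQuadraticBranchMinusLFunction f p ϖ Lη →
        ∀ (κ : ZpExtension ℚ p) (γ : Field.absoluteGaloisGroup ℚ),
          κ.IsCyclotomic → κ.IsTopGenerator γ → IsCyclotomicVariable p γ →
        ∀ (D : StrictSignedSelmerDualData W κ ℚ_[p] γ (-1)) (L' : IwasawaAlgebra p),
          Lη = PowerSeries.X * L' → D.charIdeal = Ideal.span {L'})
    (hp2 : p ≠ 2)
    (hv0 : padicValNat p ((W.baseChange (((primesEquiv (R := 𝓞 ℚ)).symm ⟨p, hp.out⟩).adicCompletion ℚ)).localTamagawaNumber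
      (((primesEquiv (R := 𝓞 ℚ)).symm ⟨p, hp.out⟩).adicCompletionIntegers ℚ)) = 0)
    (hCV : C • W.quadraticTwist ((-1) ^ (p / 2) * p) = V)
    (hgood : V.HasGoodReductionAtPrime p) (hap : V.frobeniusTrace p = 0) (hr : W.analyticRank = 1)
    (h1 : QuadraticBranchPlusMainConjectureAt V p) (hf : IsNewformOf V f)
    (hϖ : if Even (p / 2) then (ϖ : ℝ) * V.realPeriodRat = plusPeriod f
        else (ϖ : ℝ) * V.imaginaryPeriodRat = minusPeriod f)
    (hL : IsQuadraticBranchMinusLFunction f p ϖ L)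
    (htors : ∀ Q : (W.baseChange ℚ_[p]).toAffine.Point, p • Q = 0 → Q = 0)
    (hP : ¬ IsOfFinAddOrder P)
    (hgen : ∀ R : W.toAffine.Point, ∃ (k : ℤ) (T : W.toAffine.Point),
      IsOfFinAddOrder T ∧ R = k • P + T)
    (hdiv : ∃ Q : (W.baseChange ℚ_[p]).toAffine.Point, p ^ n • Q = W.toPadicPoint p P)
    (hndiv : ∀ Q : (W.baseChange ℚ_[p]).toAffine.Point, p ^ (n + 1) • Q ≠ W.toPadicPoint p P) :
    Finite ↥(strictSelmerPInfty W p) ∧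
      (padicValNat p (Nat.card ↥(strictSelmerPInfty W p)) : ℤ) + n +
          padicValRat p ((W.tamagawaProduct : ℚ) / (W.torsionOrder : ℚ) ^ 2) =
        ((PowerSeries.coeff 1 L : ℤ_[p]) : ℚ_[p]).valuation := by
  -- adapted from Additive/QuadraticBranchOddStrictExactControlDischarge.lean §1 (x1b file 123), `hp5 ↦ hp2 + hv0`
  set v₀ := (Rat.HeightOneSpectrum.primesEquiv (R := 𝓞 ℚ)).symm ⟨p, hp.out⟩ with hv₀
  obtain ⟨-, hfin⟩ := hGZK W hr.le
  haveI : Finite W.sha := hfin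
  haveI hSha : Finite (AddCommGroup.primaryComponent W.sha p) := inferInstance
  obtain ⟨γ, hγ, hχ⟩ := CyclotomicZp.exists_isTopGenerator_zpExtension p
  have hκ := CyclotomicZp.isCyclotomic_zpExtension p
  have hγc : IsCyclotomicVariable p γ := ⟨1, IsOfFinOrder.one, by rw [mul_one]; exact hχ⟩
  obtain ⟨D⟩ := nonempty_strictSignedSelmerDualData W (CyclotomicZp.zpExtension p) ℚ_[p] (-1) hγ
  obtain ⟨L', hLL', hL'0⟩ := hL.exists_eq_X_mul
  have hchar : D.charIdeal = Ideal.span {L'} :=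
    h74x V C hp2 hCV hgood hap h1 hf ϖ hϖ L hL _ γ hκ hγ hγc D L' hLL'
  obtain ⟨S, hS⟩ := exists_finset_forall_not_mem_good W p
  have hpT : v₀ ∉ S.erase v₀ := fun h ↦ (Finset.mem_erase.mp h).1 rfl
  have hTmem : ∀ v : HeightOneSpectrum (𝓞 ℚ), v ≠ v₀ →
      p ∣ (W.baseChange (v.adicCompletion ℚ)).localTamagawaNumber (v.adicCompletionIntegers ℚ) →
        v ∈ S.erase v₀ := by
    intro v hv hdvd
    refine Finset.mem_erase.mpr ⟨hv, ?_⟩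
    by_contra hvS
    rw [W.localTamagawaNumber_eq_one_of_hasGoodReductionAt_holds v (hS v hvS).2] at hdvd
    exact hp.out.one_lt.ne' (Nat.dvd_one.mp hdvd)
  have hSel := card_sha_mul_eq_pow_of_oddBranchNoFiniteSubmodule_of_quadraticTwist_signedPrime_rankOne W
    (CyclotomicZp.zpExtension p) hp2 hκ C V hCV hgood hap hPT P hP hgen hdiv hndiv (S.erase v₀) hpT hTmem hγ D
    hchar hR2
  have hidx := StrictSha.strictSelmerIndexAt_holds W p P n hP hgen htors hdiv hndiv
  have hTamSum := sum_padicValNat_localTamagawaNumber_eq_padicValNat_tamagawaProduct W p (S.erase v₀) hpT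
    hTmem hv0
  have htors0 := padicValNat_torsionOrder_eq_zero_of_noPTorsion W p htors
  have hSha0 : Nat.card (AddCommGroup.primaryComponent W.sha p) ≠ 0 := Nat.card_pos.ne'
  have hp0 : p ≠ 0 := hp.out.ne_zero
  rw [Finset.prod_pow_eq_pow_sum, ← pow_add, hTamSum] at hSel
  have hval := congrArg (padicValNat p) hSel
  rw [padicValNat.mul hSha0 (pow_ne_zero _ hp0), padicValNat.prime_pow, padicValNat.prime_pow] at hval
  have hidxval : padicValNat p (Nat.card ↥(strictSelmerPInfty W p)) =
      n + padicValNat p (Nat.card (AddCommGroup.primaryComponent W.sha p)) := by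
    rw [hidx, padicValNat.mul (pow_ne_zero _ hp0) hSha0, padicValNat.prime_pow]
  refine ⟨Nat.finite_of_card_ne_zero (by rw [hidx]; exact mul_ne_zero (pow_ne_zero _ hp0) hSha0), ?_⟩
  have hTamQ : (W.tamagawaProduct : ℚ) ≠ 0 := by exact_mod_cast W.tamagawaProduct_pos_holds.ne'
  have htQ : (W.torsionOrder : ℚ) ≠ 0 := by exact_mod_cast W.torsionOrder_pos_holds.ne'
  have hrat : padicValRat p ((W.tamagawaProduct : ℚ) / (W.torsionOrder : ℚ) ^ 2) =
      (padicValNat p W.tamagawaProduct : ℤ) := by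
    rw [padicValRat.div hTamQ (pow_ne_zero 2 htQ), padicValRat.pow, padicValRat.of_nat, padicValRat.of_nat,
      htors0]
    simp
  have hv' : ((PowerSeries.coeff 1 L : ℤ_[p]) : ℚ_[p]).valuation =
      ((((PowerSeries.constantCoeff L' : ℤ_[p]) : ℚ_[p]).valuation).toNat : ℤ) := by
    rw [← hL'0]
    exact (Int.toNat_of_nonneg (PadicInt.valuation_coe_nonneg)).symm
  rw [hrat, hv', hidxval, ← hval]
  push_cast
  ring

/-- **`BSD(W, p)` at any ODD `p` from the PAIR VALUES**: the law at the pair (`hv2`: `coeff₁ L ≠ 0` and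
`v_p(coeff₁ L) = 2n + ord_p(q·Tam/#tors²)` whenever `#Ш_an(W) = q`), (C1_η) at the twin, the readings
(R2) (typed) and `h74x` (exact), `hmod hGZ hGZK hPT`, `p ≠ 2`, `ord_p c_p(W) = 0`. cc-typer-6's p307042 §4 /
x1b's file 124 with both typed inputs replaced by their values at the pair. CONDITIONAL; nothing booked.
[cite: Miller2011LMS, §1 and Def. 1.1] [cite: Kobayashi2003, §4 (p. 8), Thm. 7.4 (p. 13), Thm. 9.3 (p. 26)]
[cite: GrossZagier1986, Thm. I.(7.3) 2) (p. 231)] -/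
theorem bsdp_of_pairValuation_of_readings_of_ne_two
    (hmod : hasEntireLFunction_rat) (hGZ : GrossZagier1986_thm_I_7_3)
    (hGZK : rank_eq_analyticRank_of_analyticRank_le_one)
    (hPT : poitouTate_selmerStructure_duality_real ℚ)
    (hR2 : OddBranchStrictMinusNoFiniteSubmoduleAt W p)
    (h74x : ∀ (V : WeierstrassCurve ℚ) [V.IsElliptic] [V.IsGloballyMinimal] (C : VariableChange ℚ)
        {N : ℕ} [NeZero N] {f : CuspForm (Gamma0 N) 2},
        p ≠ 2 → C • W.quadraticTwist ((-1) ^ (p / 2) * p) = V →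
        V.HasGoodReductionAtPrime p → V.frobeniusTrace p = 0 →
        QuadraticBranchPlusMainConjectureAt V p → IsNewformOf V f →
        ∀ (ϖ : ℚ), (if Even (p / 2) then (ϖ : ℝ) * V.realPeriodRat = plusPeriod f
            else (ϖ : ℝ) * V.imaginaryPeriodRat = minusPeriod f) →
        ∀ (Lη : IwasawaAlgebra p), IsQuadraticBranchMinusLFunction f p ϖ Lη →
        ∀ (κ : ZpExtension ℚ p) (γ : Field.absoluteGaloisGroup ℚ),
          κ.IsCyclotomic → κ.IsTopGenerator γ → IsCyclotomicVariable p γ →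
        ∀ (D : StrictSignedSelmerDualData W κ ℚ_[p] γ (-1)) (L' : IwasawaAlgebra p),
          Lη = PowerSeries.X * L' → D.charIdeal = Ideal.span {L'})
    (hv2 : ∀ q : ℚ, shaAn W = (q : ℂ) →
      PowerSeries.coeff 1 L ≠ 0 ∧
        ((PowerSeries.coeff 1 L : ℤ_[p]) : ℚ_[p]).valuation =
          2 * (n : ℤ) + padicValRat p (q * W.tamagawaProduct / (W.torsionOrder : ℚ) ^ 2))
    (hp2 : p ≠ 2)
    (hv0 : padicValNat p ((W.baseChange (((primesEquiv (R := 𝓞 ℚ)).symm ⟨p, hp.out⟩).adicCompletion ℚ)).localTamagawaNumber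
      (((primesEquiv (R := 𝓞 ℚ)).symm ⟨p, hp.out⟩).adicCompletionIntegers ℚ)) = 0)
    (hCV : C • W.quadraticTwist ((-1) ^ (p / 2) * p) = V)
    (hgood : V.HasGoodReductionAtPrime p) (hap : V.frobeniusTrace p = 0)
    (h1 : QuadraticBranchPlusMainConjectureAt V p) (hf : IsNewformOf V f)
    (hϖ : if Even (p / 2) then (ϖ : ℝ) * V.realPeriodRat = plusPeriod f
        else (ϖ : ℝ) * V.imaginaryPeriodRat = minusPeriod f)
    (hL : IsQuadraticBranchMinusLFunction f p ϖ L)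
    (htors : ∀ Q : (W.baseChange ℚ_[p]).toAffine.Point, p • Q = 0 → Q = 0)
    (hP : ¬ IsOfFinAddOrder P)
    (hgen : ∀ R : W.toAffine.Point, ∃ (k : ℤ) (T : W.toAffine.Point),
      IsOfFinAddOrder T ∧ R = k • P + T)
    (hdiv : ∃ Q : (W.baseChange ℚ_[p]).toAffine.Point, p ^ n • Q = W.toPadicPoint p P)
    (hndiv : ∀ Q : (W.baseChange ℚ_[p]).toAffine.Point, p ^ (n + 1) • Q ≠ W.toPadicPoint p P)
    (hr : W.analyticRank = 1) : BSDp W p := by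
  -- adapted from Additive/QuadraticBranchOddStrictExactControl.lean §4 (cc-typer-6, p307042)
  obtain ⟨hrank, hfin⟩ := hGZK W hr.le
  haveI : Finite W.sha := hfin
  obtain ⟨s, hs⟩ := Disegni2020.exists_rat_shaAn_eq_of_analyticRank_eq_one hGZ hGZK W hr
  have hs0 : s ≠ 0 := by
    rintro rfl
    exact AdditivePotMult.shaAn_ne_zero W hmod (by rw [hs, Rat.cast_zero])
  have hc : (W.tamagawaProduct : ℚ) ≠ 0 := by exact_mod_cast W.tamagawaProduct_pos_holds.ne'
  have ht : (W.torsionOrder : ℚ) ≠ 0 := by exact_mod_cast W.torsionOrder_pos_holds.ne'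
  have hct : (W.tamagawaProduct : ℚ) / (W.torsionOrder : ℚ) ^ 2 ≠ 0 :=
    div_ne_zero hc (pow_ne_zero 2 ht)
  obtain ⟨-, hv2'⟩ := hv2 s hs
  have hsplit : padicValRat p (s * W.tamagawaProduct / (W.torsionOrder : ℚ) ^ 2) =
      padicValRat p s + padicValRat p ((W.tamagawaProduct : ℚ) / (W.torsionOrder : ℚ) ^ 2) := by
    rw [mul_div_assoc, padicValRat.mul hs0 hct]
  obtain ⟨-, hv3⟩ := exactControlValue_of_readings_of_ne_two W hPT hGZK hR2 h74x hp2 hv0 hCV hgood hap hr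
    h1 hf hϖ hL htors hP hgen hdiv hndiv
  haveI : Finite (AddCommGroup.primaryComponent W.sha p) := inferInstance
  have hI := (StrictSha.strictSelmerIndexAt_holds W p).padicValNat_card_eq hP hgen htors hdiv hndiv
  refine ⟨hrank, inferInstance, s, hs, ?_⟩
  rw [hI, Nat.cast_add] at hv3
  rw [hsplit] at hv2'
  linarith

end BSDpPair

/-- **THE TYPED MISSING INPUT ON THE SIGNED TYPE `(p, I₀*)` AT ANY ODD `p`** — `∀ W` of signed local type
`(p, I₀*)` with `r_an(W) = 1`, `Typed.X12.MissingInputAt W p` — ⟸ the law in pair form on the type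
(`hlaw`) ∧ (C1_η) on the CM good-inert curves ∧ `hmod hGZ hGZK hPT hnf` ∧ the readings on the type ((R2)
typed, `h74x` exact) ∧ `hper` ∧ `ord_p c_p = 0` on the type. The odd-`p` twin of the bridge's `I₀*` branch
(`CMRungInputs.cmInertBad_of_inputs` / `X12.O10.bsdp_of_hasSignedLocalType_IstarZero_of_valuation_of_readings`).
CONDITIONAL on every displayed hypothesis; nothing booked. [cite: Kobayashi2003, §4 (p. 8), Thm. 7.4 (p. 13)]
[cite: KitajimaOtsuki2018, Main Thm. 1.3 (arXiv:1607.03612 p. 3)] [cite: Miller2011LMS, §1 and Def. 1.1] -/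
theorem missingInputAt_IstarZero_of_pairLaw_of_readings_of_ne_two
    (hmod : hasEntireLFunction_rat) (hGZ : GrossZagier1986_thm_I_7_3)
    (hGZK : rank_eq_analyticRank_of_analyticRank_le_one)
    (hPT : poitouTate_selmerStructure_duality_real ℚ) (hnf : exists_isNewformOf)
    (hper : ∀ (V : WeierstrassCurve ℚ) [V.IsElliptic] [V.IsGloballyMinimal]
      {N : ℕ} [NeZero N] (f : CuspForm (Gamma0 N) 2), IsNewformOf V f →
      V.HasGoodReductionAtPrime p → V.frobeniusTrace p = 0 →
      ∃ ϖ : ℚ, ‖(ϖ : ℚ_[p])‖ ≤ 1 ∧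
        (if Even (p / 2) then (ϖ : ℝ) * V.realPeriodRat = plusPeriod f
          else (ϖ : ℝ) * V.imaginaryPeriodRat = minusPeriod f))
    (hlaw : ∀ (W : WeierstrassCurve ℚ) [W.IsElliptic] [W.IsGloballyMinimal],
      HasSignedLocalType W p (.Istar 0) → W.analyticRank = 1 →
      ∀ (V : WeierstrassCurve ℚ) [V.IsElliptic] [V.IsGloballyMinimal] (C : VariableChange ℚ)
        {N : ℕ} [NeZero N] {f : CuspForm (Gamma0 N) 2},
        C • W.quadraticTwist ((-1) ^ (p / 2) * p) = V →
        V.HasGoodReductionAtPrime p → V.frobeniusTrace p = 0 → IsNewformOf V f →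
        ∀ (ϖ : ℚ), (if Even (p / 2) then (ϖ : ℝ) * V.realPeriodRat = plusPeriod f
            else (ϖ : ℝ) * V.imaginaryPeriodRat = minusPeriod f) →
        ∀ (L : IwasawaAlgebra p), IsQuadraticBranchMinusLFunction f p ϖ L →
        (∀ Q : (W.baseChange ℚ_[p]).toAffine.Point, p • Q = 0 → Q = 0) →
        ∀ (P : W.toAffine.Point) (n : ℕ), ¬ IsOfFinAddOrder P →
        (∀ R : W.toAffine.Point, ∃ (k : ℤ) (T : W.toAffine.Point), IsOfFinAddOrder T ∧ R = k • P + T) →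
        (∃ Q : (W.baseChange ℚ_[p]).toAffine.Point, p ^ n • Q = W.toPadicPoint p P) →
        (∀ Q : (W.baseChange ℚ_[p]).toAffine.Point, p ^ (n + 1) • Q ≠ W.toPadicPoint p P) →
        ∀ (q : ℚ), shaAn W = (q : ℂ) →
        PowerSeries.coeff 1 L ≠ 0 ∧
          ((PowerSeries.coeff 1 L : ℤ_[p]) : ℚ_[p]).valuation =
            2 * (n : ℤ) + padicValRat p (q * W.tamagawaProduct / (W.torsionOrder : ℚ) ^ 2))
    (hRd : ∀ (W : WeierstrassCurve ℚ) [W.IsElliptic] [W.IsGloballyMinimal],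
      HasSignedLocalType W p (.Istar 0) → W.analyticRank = 1 →
      OddBranchStrictMinusNoFiniteSubmoduleAt W p ∧
      ∀ (V : WeierstrassCurve ℚ) [V.IsElliptic] [V.IsGloballyMinimal] (C : VariableChange ℚ)
        {N : ℕ} [NeZero N] {f : CuspForm (Gamma0 N) 2},
        p ≠ 2 → C • W.quadraticTwist ((-1) ^ (p / 2) * p) = V →
        V.HasGoodReductionAtPrime p → V.frobeniusTrace p = 0 →
        QuadraticBranchPlusMainConjectureAt V p → IsNewformOf V f →
        ∀ (ϖ : ℚ), (if Even (p / 2) then (ϖ : ℝ) * V.realPeriodRat = plusPeriod f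
            else (ϖ : ℝ) * V.imaginaryPeriodRat = minusPeriod f) →
        ∀ (Lη : IwasawaAlgebra p), IsQuadraticBranchMinusLFunction f p ϖ Lη →
        ∀ (κ : ZpExtension ℚ p) (γ : Field.absoluteGaloisGroup ℚ),
          κ.IsCyclotomic → κ.IsTopGenerator γ → IsCyclotomicVariable p γ →
        ∀ (D : StrictSignedSelmerDualData W κ ℚ_[p] γ (-1)) (L' : IwasawaAlgebra p),
          Lη = PowerSeries.X * L' → D.charIdeal = Ideal.span {L'})
    (hC1 : ∀ (V : WeierstrassCurve ℚ) [V.IsElliptic] [V.IsGloballyMinimal], V.HasCM →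
      V.HasGoodReductionAtPrime p → CMInert V p → QuadraticBranchPlusMainConjectureAt V p)
    (hcp : ∀ (W : WeierstrassCurve ℚ) [W.IsElliptic] [W.IsGloballyMinimal],
      HasSignedLocalType W p (.Istar 0) →
      padicValNat p ((W.baseChange (((primesEquiv (R := 𝓞 ℚ)).symm ⟨p, hp.out⟩).adicCompletion ℚ)).localTamagawaNumber
        (((primesEquiv (R := 𝓞 ℚ)).symm ⟨p, hp.out⟩).adicCompletionIntegers ℚ)) = 0)
    (hp2 : p ≠ 2) :
    ∀ (W : WeierstrassCurve ℚ) [W.IsElliptic] [W.IsGloballyMinimal],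
      HasSignedLocalType W p (.Istar 0) → W.analyticRank = 1 → X12.MissingInputAt W p := by
  intro W _ _ hT hr
  obtain ⟨hR2, h74x⟩ := hRd W hT hr
  have hB : BSDp W p := pairData_elim_of_ne_two W hGZK hnf hper hT hr hp2
    fun V _ _ C _ _ _ ϖ L P n hC hgood hap hCM hin hf hϖ hL htors hP hgen hdiv hndiv ↦
      bsdp_of_pairValuation_of_readings_of_ne_two W hmod hGZ hGZK hPT hR2 h74x
        (hlaw W hT hr V C hC hgood hap hf ϖ hϖ L hL htors P n hP hgen hdiv hndiv)
        hp2 (hcp W hT) hC hgood hap (hC1 V hCM hgood hin) hf hϖ hL htors hP hgen hdiv hndiv hr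
  haveI : Finite W.sha := (hGZK W (by rw [hr])).2
  exact fun _ ↦ missingPPartAt_of_bsdp W p hB


/-- **THE `I₀*`-AT-3 CHILD OF `InertBadAtThree` MODULO ITS PRINT/PAPER INPUTS (D71 child 1, O10-PS@3, 57
classes `N < 5·10⁵`)**: for every globally minimal `W` of signed local type `(3, I₀*)` with `r_an(W) = 1`,
`Typed.X12.MissingInputAt W 3` ⟸ C-cc-1@3 in pair form on the type (`hlaw`) ∧ (C1_η)@3 on the CM
good-inert curves ∧ named facts ∧ the readings at `3` on the type ((R2) typed + Kobayashi 7.4 (ii) exact)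
∧ `hper` at `3` — the Tamagawa hypothesis DISCHARGED (`3 ∤ Tam(W)`, §0) and the parity data read at
`p* = −3`. I.e. the `p = 3` twin of the route's `I₀*` branch at `p ≥ 5`; what stays displayed is exactly
what is displayed at `p ≥ 5`. CONDITIONAL; nothing booked; the `III/III*`-at-3 child untouched.
[cite: Kobayashi2003, §4 (p. 8), Thm. 7.4 (p. 13)] [cite: KitajimaOtsuki2018, Main Thm. 1.3 (arXiv:1607.03612 p. 3)]
[cite: SilvermanATAEC1994, IV.9.4 and Table 4.1] [cite: Miller2011LMS, §1 and Def. 1.1] -/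
theorem missingInputAt_IstarZero_three_of_pairLaw_of_readings [h3 : Fact (Nat.Prime 3)]
    (hmod : hasEntireLFunction_rat) (hGZ : GrossZagier1986_thm_I_7_3)
    (hGZK : rank_eq_analyticRank_of_analyticRank_le_one)
    (hPT : poitouTate_selmerStructure_duality_real ℚ) (hnf : exists_isNewformOf)
    (hper : ∀ (V : WeierstrassCurve ℚ) [V.IsElliptic] [V.IsGloballyMinimal]
      {N : ℕ} [NeZero N] (f : CuspForm (Gamma0 N) 2), IsNewformOf V f →
      V.HasGoodReductionAtPrime 3 → V.frobeniusTrace 3 = 0 →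
      ∃ ϖ : ℚ, ‖(ϖ : ℚ_[3])‖ ≤ 1 ∧ (ϖ : ℝ) * V.imaginaryPeriodRat = minusPeriod f)
    (hlaw : ∀ (W : WeierstrassCurve ℚ) [W.IsElliptic] [W.IsGloballyMinimal],
      HasSignedLocalType W 3 (.Istar 0) → W.analyticRank = 1 →
      ∀ (V : WeierstrassCurve ℚ) [V.IsElliptic] [V.IsGloballyMinimal] (C : VariableChange ℚ)
        {N : ℕ} [NeZero N] {f : CuspForm (Gamma0 N) 2},
        C • W.quadraticTwist (-3) = V →
        V.HasGoodReductionAtPrime 3 → V.frobeniusTrace 3 = 0 → IsNewformOf V f →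
        ∀ (ϖ : ℚ), (ϖ : ℝ) * V.imaginaryPeriodRat = minusPeriod f →
        ∀ (L : IwasawaAlgebra 3), IsQuadraticBranchMinusLFunction f 3 ϖ L →
        (∀ Q : (W.baseChange ℚ_[3]).toAffine.Point, 3 • Q = 0 → Q = 0) →
        ∀ (P : W.toAffine.Point) (n : ℕ), ¬ IsOfFinAddOrder P →
        (∀ R : W.toAffine.Point, ∃ (k : ℤ) (T : W.toAffine.Point), IsOfFinAddOrder T ∧ R = k • P + T) →
        (∃ Q : (W.baseChange ℚ_[3]).toAffine.Point, 3 ^ n • Q = W.toPadicPoint 3 P) →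
        (∀ Q : (W.baseChange ℚ_[3]).toAffine.Point, 3 ^ (n + 1) • Q ≠ W.toPadicPoint 3 P) →
        ∀ (q : ℚ), shaAn W = (q : ℂ) →
        PowerSeries.coeff 1 L ≠ 0 ∧
          ((PowerSeries.coeff 1 L : ℤ_[3]) : ℚ_[3]).valuation =
            2 * (n : ℤ) + padicValRat 3 (q * W.tamagawaProduct / (W.torsionOrder : ℚ) ^ 2))
    (hRd : ∀ (W : WeierstrassCurve ℚ) [W.IsElliptic] [W.IsGloballyMinimal],
      HasSignedLocalType W 3 (.Istar 0) → W.analyticRank = 1 →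
      OddBranchStrictMinusNoFiniteSubmoduleAt W 3 ∧
      ∀ (V : WeierstrassCurve ℚ) [V.IsElliptic] [V.IsGloballyMinimal] (C : VariableChange ℚ)
        {N : ℕ} [NeZero N] {f : CuspForm (Gamma0 N) 2},
        (3 : ℕ) ≠ 2 → C • W.quadraticTwist (-3) = V →
        V.HasGoodReductionAtPrime 3 → V.frobeniusTrace 3 = 0 →
        QuadraticBranchPlusMainConjectureAt V 3 → IsNewformOf V f →
        ∀ (ϖ : ℚ), (ϖ : ℝ) * V.imaginaryPeriodRat = minusPeriod f →
        ∀ (Lη : IwasawaAlgebra 3), IsQuadraticBranchMinusLFunction f 3 ϖ Lη →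
        ∀ (κ : ZpExtension ℚ 3) (γ : Field.absoluteGaloisGroup ℚ),
          κ.IsCyclotomic → κ.IsTopGenerator γ → IsCyclotomicVariable 3 γ →
        ∀ (D : StrictSignedSelmerDualData W κ ℚ_[3] γ (-1)) (L' : IwasawaAlgebra 3),
          Lη = PowerSeries.X * L' → D.charIdeal = Ideal.span {L'})
    (hC1 : ∀ (V : WeierstrassCurve ℚ) [V.IsElliptic] [V.IsGloballyMinimal], V.HasCM →
      V.HasGoodReductionAtPrime 3 → CMInert V 3 → QuadraticBranchPlusMainConjectureAt V 3) :
    ∀ (W : WeierstrassCurve ℚ) [W.IsElliptic] [W.IsGloballyMinimal],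
      HasSignedLocalType W 3 (.Istar 0) → W.analyticRank = 1 → X12.MissingInputAt W 3 := by
  have h32 : ((-1 : ℚ) ^ (3 / 2) * (3 : ℕ)) = -3 := by norm_num
  have hodd : ¬ Even (3 / 2) := by decide
  refine missingInputAt_IstarZero_of_pairLaw_of_readings_of_ne_two (p := 3) hmod hGZ hGZK hPT hnf
    ?_ ?_ ?_ hC1 (fun W _ _ hT ↦ ?_) (by decide)
  · intro V _ _ N _ f hf hgood hap
    obtain ⟨ϖ, hϖ, hrel⟩ := hper V f hf hgood hap
    exact ⟨ϖ, hϖ, by rw [if_neg hodd]; exact hrel⟩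
  · intro W _ _ hT hr V _ _ C N _ f hC hgood hap hf ϖ hϖ L hL htors P n hP hgen hdiv hndiv q hq
    rw [h32] at hC
    rw [if_neg hodd] at hϖ
    exact hlaw W hT hr V C hC hgood hap hf ϖ hϖ L hL htors P n hP hgen hdiv hndiv q hq
  · intro W _ _ hT hr
    obtain ⟨hR2, h74x⟩ := hRd W hT hr
    refine ⟨hR2, ?_⟩
    intro V _ _ C N _ f h2 hC hgood hap h1 hf ϖ hϖ Lη hLη κ γ hκ hγ hγc D L' hLL'
    rw [h32] at hC
    rw [if_neg hodd] at hϖ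
    exact h74x V C h2 hC hgood hap h1 hf ϖ hϖ Lη hLη κ γ hκ hγ hγc D L' hLL'
  · exact padicValNat_localTamagawaNumber_eq_zero_of_hasCM_three W hT.1
      (not_cmRamified_of_hasSignedLocalType W 3 hT)

end Summit.BirchSwinnertonDyer.BirchSwinnertonDyer.Theorems.InertBadOdd

end
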